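import Mathlib
import Summits.Ventures.HodgeRepro2.Tier7.Line2.GaloisDefs
import Summits.Ventures.HodgeRepro2.Tier7.Line2.Eps

/-!
# Tier7/Line2/SquareZeroInstance — the square-zero model carries a `RationalStructure` (LEMMA 7 of `Line2/Galois`)

Filer: t7-L1-p3 (gen 2, prover-pub-hodge-repro2-t7-L1-p3-g2-0), on plan-2's lemma cut `route/t7/Line2/GALOIS-LEMMAS.md`
item 7 and the chain ruling STATUS ll. 14978 / 14981 / 14988 (the (A′) pre-emption lives in this module, Galois.lean
carries a pointer). Lane: SUPPORT for the Line-2 Galois-transport module (itself support for Line 3's residual); NOT a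
line, NOT a device.

WHAT IT SHOWS (the t7-lead's condition (3), l. 14933): `RationalStructure D` is an INTERFACE a junk datum carries too.
Any datum whose shadow is square-zero on 1-classes (`(g • alb v) * (h • alb w) = 0`), with `intX = 0`,
`bar ∘ alb = alb ∘ conjH1` and a trivial Hecke action, carries a rational structure — in particular the junk datum
of the frozen counter-model (crit-1 JunkModel-frozen 9c0b26dd…). Hence no field of the interface closes `C D` on its
own (the one-point / square-zero check of the critics).

PROOF. The idempotents are `Eps.exists_eps K` (the splitting `K ⊗_ℚ ℂ ≅ ∏_σ ℂ`, Mathlib-only); `omegaAt i σ` is the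
line `ℂ • alb (slot i ε_σ)` — non-zero by `alb_inj` and `ε_σ ≠ 0`, inside `H^{1,0}` for `σ ∈ T i` by `alb_h10`,
Hecke-irreducible because every Hecke translate acts trivially (a submodule of a line is `⊥` or the line);
`rat` holds with `q = 0` (`intX = 0`); `anticomm` reads `0 = -0`; `alb_conj` is the hypothesis; the centre acts by `1`.

§8(d) (uses an L-value-free non-vanishing device): NO — the instance produces no non-vanishing; nothing about (P).
-/

namespace Summit.Ventures.HodgeRepro2.Tier7.Line2.Galois

open Summit.Ventures.HodgeRepro2.T6 (KC H1C eigenLine eigenLineK)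
open Summit.Ventures.HodgeRepro2.Tier7

noncomputable section

variable {K : Type} [Field K] [NumberField K] {E' : Type} [Field E'] [NumberField E']
  {V : Type} [AddCommGroup V] [Module E' V] {HX : Type} [Ring HX] [Algebra ℂ HX]
  {G : Type} [Group G] [MulAction G HX]

/-! ## (A′) pre-emption: the square-zero model carries a rational structure -/

variable {D : PeriodDatum K E' V HX G}

/-- a submodule of the line `ℂ • v` is `⊥` or the line -/
theorem eq_bot_or_eq_span_of_le_span {W : Submodule ℂ HX} {v : HX}
    (hW : W ≤ Submodule.span ℂ {v}) : W = ⊥ ∨ W = Submodule.span ℂ {v} := by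
  rcases eq_or_ne W ⊥ with h | h
  · exact Or.inl h
  · right
    obtain ⟨w, hwW, hw0⟩ := Submodule.exists_mem_ne_zero_of_ne_bot h
    obtain ⟨c, rfl⟩ := Submodule.mem_span_singleton.1 (hW hwW)
    have hc : c ≠ 0 := by
      rintro rfl
      exact hw0 (zero_smul ℂ v)
    refine le_antisymm hW ?_
    rw [Submodule.span_singleton_le_iff_mem]
    have : v = c⁻¹ • (c • v) := by rw [smul_smul, inv_mul_cancel₀ hc, one_smul]
    rw [this]
    exact W.smul_mem _ hwW

/-- under a trivial Hecke action the line through a non-zero vector is Hecke-irreducible -/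
theorem heckeIrred_span_singleton_of_trivial (htriv : ∀ (g : G) (a : HX), g • a = a) {v : HX} (hv : v ≠ 0) :
    HeckeIrred G (Submodule.span ℂ {v}) := by
  refine ⟨?_, fun g a ha => by rw [htriv]; exact ha, fun W hW _ => eq_bot_or_eq_span_of_le_span hW⟩
  rw [Ne, Submodule.span_singleton_eq_bot]
  exact hv

/-- `slot i u ≠ 0` for `u ≠ 0` -/
theorem slot_ne_zero (i : Fin 4) {u : KC K} (hu : u ≠ 0) : slot i u ≠ 0 := by
  intro h
  apply hu
  have := congrFun h i
  simpa [slot] using this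

/-- `slot i u ∈ F.h10` for `u ∈ eigenLineK K σ` and `σ ∈ F.T i` -/
theorem slot_mem_h10 (F : Face K) (i : Fin 4) {σ : K →+* ℂ} (hσ : σ ∈ F.T i) {u : KC K}
    (hu : u ∈ eigenLineK K σ) : slot i u ∈ F.h10 := by
  refine Submodule.mem_iSup_of_mem i (Submodule.mem_iSup_of_mem σ (Submodule.mem_iSup_of_mem hσ ?_))
  exact Submodule.mem_map_of_mem hu

/-- Any datum whose shadow is square-zero on 1-classes (`alb v * alb w = 0`), with `intX = 0`, `bar ∘ alb = alb ∘ conjH1`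
and a trivial Hecke action, carries a rational structure — in particular the junk datum of the frozen counter-model.
The idempotent family is the splitting `K ⊗ ℂ ≅ ∏_σ ℂ` (`Eps.exists_eps`); `omegaAt i σ` is the line through
`alb (slot i ε_σ)` (non-zero by `alb_inj`), Hecke-irreducible because the action is trivial; `rat` holds with `q = 0`;
`anticomm` reads `0 = -0`; the centre acts by the scalar `1`. -/
theorem rationalStructure_of_squareZero (D : PeriodDatum K E' V HX G)
    (hsq : ∀ (g h : G) (v w : H1C K), (g • D.alb v) * (h • D.alb w) = 0)
    (hint : ∀ a : HX, D.S.intX a = 0)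
    (hbar : ∀ v : H1C K, D.S.bar (D.alb v) = D.alb (conjH1 v))
    (htriv : ∀ (g : G) (a : HX), g • a = a) :
    Nonempty (RationalStructure D) := by
  obtain ⟨eps, heigen, hne, hsum, hdim, hconj⟩ := Eps.exists_eps K
  have hmem : ∀ σ : K →+* ℂ, eps σ ∈ eigenLineK K σ := fun σ x => heigen σ x
  have halb_ne : ∀ (i : Fin 4) (σ : K →+* ℂ), D.alb (slot i (eps σ)) ≠ 0 := fun i σ h =>
    slot_ne_zero i (hne σ) (D.alb_inj (h.trans (map_zero D.alb).symm))
  refine ⟨{ eps := eps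
            eps_eigen := heigen
            eps_ne := hne
            eps_sum := hsum
            eigen_dim := hdim
            eps_conj := hconj
            alb_conj := hbar
            anticomm := fun g h v w => by rw [hsq, hsq, neg_zero]
            rat := fun g x => ⟨0, by rw [hint]; simp⟩
            omegaAt := fun i σ => Submodule.span ℂ {D.alb (slot i (eps σ))}
            omegaAt_le := fun i σ hσ => ?_
            omegaAt_irred := fun i σ => heckeIrred_span_singleton_of_trivial htriv (halb_ne i σ)
            alb_eps_mem := fun i σ => Submodule.mem_span_singleton_self _
            omegaAt_center_scalar := fun i σ z _ => ⟨1, fun a _ => by rw [htriv, one_smul]⟩ }⟩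
  rw [Submodule.span_singleton_le_iff_mem]
  exact D.alb_h10 _ (slot_mem_h10 D.F i hσ (hmem σ))

end

end Summit.Ventures.HodgeRepro2.Tier7.Line2.Galois
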